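/-
Copyright (c) 2026 the pub-hodgecm-mathlib formalisation cell (harness21).  Prover seat hodgecm-mathlib-K2E4-p18 (g3), HCML Track B «K2-LIT» ∕ h413
(stmt-HodgeConjecture-24833); line (ii′), sub-letters (H♮)∕(H) PAID BY NAME (2026-09-04).
-/
import Summits.HodgeConjecture.HodgeConjecture.Theorems.K2E3CentralGermIndependenceNstOfHomogeneityRay          -- ★ p855908 (this seat): (H♮)∕(H) ⟸ (HOM-ray♮)
import Summits.HodgeConjecture.HodgeConjecture.Theorems.K2E3CentralGermHomogeneityRayNstOfReference              -- ★ p855909 (this seat): (HOM-ray♮) ⟸ (DUAL_z) + (HOM-ray*♮)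
import Summits.HodgeConjecture.HodgeConjecture.Theorems.K2E3CentralGermHomogeneityRayNstRefOfUnipotentScaling    -- ★ p855910 (this seat): (HOM-ray*♮) ⟸ (E) + (DUAL_z) + (Ψ-package♮)
import Summits.HodgeConjecture.HodgeConjecture.Theorems.K2E3CentralUnipotentDualPieces                            -- ★ p855937 (K2E4-p21 (g2)): (DUAL_z)
import Summits.HodgeConjecture.HodgeConjecture.Theorems.K2E3CentralGermExpansionExistence                         -- ★ (K2E3-p23 (g2)): (E)
import Summits.HodgeConjecture.HodgeConjecture.Theorems.K2E3CentralUnipotentScalingPackageOfRankOne               -- ★ p856124 (this seat): (Ψ-package♮) ⟸ (Ψ-package₂⁺)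
import Summits.HodgeConjecture.HodgeConjecture.Theorems.K2E3RankOneUnipotentScalingPackageOfIdentity             -- ★ p856384 (this seat): (Ψ-package₂⁺) ⟸ (Ψ-package₂¹)
import Summits.HodgeConjecture.HodgeConjecture.Theorems.K2E3RankOneUnipotentScalingPackageOne                    -- ★ p856553 (K2E5-p12 (g2)): (Ψ-package₂¹) — the Cayley road
import HarnessLib

/-!
# K2 · E3 — `Theorems/K2E3CentralGermIndependence.lean`: (H♮) AND (H) OF LINE (ii′) PAID BY NAME — «INDEPENDENCE OF THE NON-CENTRAL GERMS (AND OF THE STABLE-CLASS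
# COUNT) FROM THE CONSTANTS» on `H_v = U(Φ₂)(L⁺_v) × U(Φ₁)(L⁺_v)` at a non-split place (Rogawski 1990 §8.1 Props. 8.1.1–8.1.2, (8.1.1)–(8.1.2))

HCML Track B «K2-LIT», cell `pub/hodgecm-mathlib`, crux H413 = `stmt-HodgeConjecture-24833` (lane `--supports … --as helper`); seat `hodgecm-mathlib-K2E4-p18` (g3).
The sub-letters (H♮) `sig_K2E3CentralGermIndependenceNst` (cand bdb28692, line lead K2E4-p06 (g2)) and (H) `sig_K2E3CentralGermIndependence` (cand abbe5717; U3b socket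
:232, dealer K2E3-plan) of line (ii′) «H-side central germ expansion with independent tails», CLOSED UNCONDITIONALLY by composing the ★ chain of this line:

  (H♮)∕(H) ⟸ ★ p855908 (HOM-ray♮) ⟸ ★ p855909 {(DUAL_z) ★ p855937, (HOM-ray*♮) ⟸ ★ p855910 {(E) ★ `centralGermExpansionExistence`, (DUAL_z), (Ψ-package♮) ⟸ ★ p856124
  (Ψ-package₂⁺) ⟸ ★ p856384 (Ψ-package₂¹) = ★ p856553 `rankOneUnipotentScalingPackageOne` (the Cayley road: ‹SC₂› ★ p856229, (α)(β)(γ) ★, (T2-EX) ★ p856408,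
  (T2-CPT) ★ p856452)}}.

* **`centralGermIndependenceNst : ‹(H♮) sig_K2E3CentralGermIndependenceNst, VERBATIM›`**
* **`centralGermIndependence : ‹(H) sig_K2E3CentralGermIndependence, VERBATIM›`**

Both statements are the hosted∕cand socket texts token for token (extracted programmatically from `K2/K2E4-p06/g2/sig_K2E3CentralGermIndependence{,Nst}.cand.K2E4-p06-g2.lean`);
the proofs are single terms — no tactic, no hypothesis.

HONEST LABEL: HC_CM is proved only modulo the 7 printed citations (2 remaining named inputs: hLiu418 = stmt-HodgeConjecture-24832, h413 = stmt-HodgeConjecture-24833) until rung 0 closes.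
Count-neutral helper: the (H)∕(H♮) sub-letters of line (ii′) become ★ by name.  No `sorry`, axioms ⊆ {propext, Classical.choice, Quot.sound}, no `def`, no instance, no notation.

## References
* [Rogawski1990] J. D. Rogawski, *Automorphic Representations of Unitary Groups in Three Variables*, Ann. of Math. Stud. 123 (1990): §8.1 Props. 8.1.1–8.1.2 pp. 112–114,
  Prop. 8.1.3 p. 116; §3.5 Prop. 3.5.2 pp. 25–26; §3.6 Lemma 3.6.1 p. 28; §4.9 p. 54.
* [HarishChandra1999AdmissibleDistributions] Harish-Chandra (notes by S. DeBacker, P. J. Sally, Jr.), AMS ULS 16 (1999): §3.1 Lemma 3.2; Thm. 8.1 p. 48.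
-/

set_option autoImplicit false
set_option linter.dupNamespace false

noncomputable section

open Filter Topology
open MeasureTheory Measure NumberField IsDedekindDomain
open Literature.MeasureTheory.Group Literature.MeasureTheory.RestrictedProduct
open Literature.Topology.RestrictedProduct Literature.Topology.Algebra.RestrictedProduct
open Literature.NumberTheory.Rogawski1990 Literature.NumberTheory.Automorphic
open Literature.AlgebraicGeometry.ShimuraVarieties (unitaryGroup hermForm)
open scoped Matrix MatrixGroups RestrictedProduct

namespace Summit.HodgeConjecture.HodgeConjecture.Cruxes.H413.K2E3CentralGermIndependence

/-- **(H♮) PAID BY NAME — INDEPENDENCE OF THE NON-CENTRAL GERMS AND OF THE STABLE-CLASS COUNT FROM THE CONSTANTS** (statement = the cand∕hosted socket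
`sig_K2E3CentralGermIndependenceNst` VERBATIM): the ★ chain of line (ii′) composed (module docstring).
[cite: Rogawski1990, §8.1 Props. 8.1.1–8.1.2 pp. 112–114; §3.5 Prop. 3.5.2 pp. 25–26] [cite: HarishChandra1999AdmissibleDistributions, §3.1 Lemma 3.2] -/
theorem centralGermIndependenceNst :
    ∀ (L : Type) [Field L] [NumberField L] [IsCMField L] (H' : Matrix (Fin 3) (Fin 3) L),
      (H'.map (cmConjRingHom L)).transpose = H' →
      (∀ x : Fin 3 → L, hermForm (cmConjRingHom L) H' x x = 0 → x = 0) →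
    ∀ (v : HeightOneSpectrum (𝓞 ↥(maximalRealSubfield L)))
      [MeasurableSpace ((UnitaryGroup.cmDatum L 2 (Matrix.of fun i j : Fin 2 => if i.val + j.val + 1 = 2 then (1 : L) else 0)).Local v × (UnitaryGroup.cmDatum L 1 (Matrix.of fun i j : Fin 1 => if i.val + j.val + 1 = 1 then (1 : L) else 0)).Local v)] [BorelSpace ((UnitaryGroup.cmDatum L 2 (Matrix.of fun i j : Fin 2 => if i.val + j.val + 1 = 2 then (1 : L) else 0)).Local v × (UnitaryGroup.cmDatum L 1 (Matrix.of fun i j : Fin 1 => if i.val + j.val + 1 = 1 then (1 : L) else 0)).Local v)]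
      [∀ a : (UnitaryGroup.cmDatum L 2 (Matrix.of fun i j : Fin 2 => if i.val + j.val + 1 = 2 then (1 : L) else 0)).Local v × (UnitaryGroup.cmDatum L 1 (Matrix.of fun i j : Fin 1 => if i.val + j.val + 1 = 1 then (1 : L) else 0)).Local v,
        MeasurableSpace (((UnitaryGroup.cmDatum L 2 (Matrix.of fun i j : Fin 2 => if i.val + j.val + 1 = 2 then (1 : L) else 0)).Local v × (UnitaryGroup.cmDatum L 1 (Matrix.of fun i j : Fin 1 => if i.val + j.val + 1 = 1 then (1 : L) else 0)).Local v) ⧸ Subgroup.centralizer ({a} : Set ((UnitaryGroup.cmDatum L 2 (Matrix.of fun i j : Fin 2 => if i.val + j.val + 1 = 2 then (1 : L) else 0)).Local v × (UnitaryGroup.cmDatum L 1 (Matrix.of fun i j : Fin 1 => if i.val + j.val + 1 = 1 then (1 : L) else 0)).Local v)))]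
      [∀ a : (UnitaryGroup.cmDatum L 2 (Matrix.of fun i j : Fin 2 => if i.val + j.val + 1 = 2 then (1 : L) else 0)).Local v × (UnitaryGroup.cmDatum L 1 (Matrix.of fun i j : Fin 1 => if i.val + j.val + 1 = 1 then (1 : L) else 0)).Local v,
        BorelSpace (((UnitaryGroup.cmDatum L 2 (Matrix.of fun i j : Fin 2 => if i.val + j.val + 1 = 2 then (1 : L) else 0)).Local v × (UnitaryGroup.cmDatum L 1 (Matrix.of fun i j : Fin 1 => if i.val + j.val + 1 = 1 then (1 : L) else 0)).Local v) ⧸ Subgroup.centralizer ({a} : Set ((UnitaryGroup.cmDatum L 2 (Matrix.of fun i j : Fin 2 => if i.val + j.val + 1 = 2 then (1 : L) else 0)).Local v × (UnitaryGroup.cmDatum L 1 (Matrix.of fun i j : Fin 1 => if i.val + j.val + 1 = 1 then (1 : L) else 0)).Local v)))]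
      [MeasurableSpace ((UnitaryGroup.cmDatum L 3 H').Local v)] [BorelSpace ((UnitaryGroup.cmDatum L 3 H').Local v)]
      [∀ γ : (UnitaryGroup.cmDatum L 3 H').Local v, MeasurableSpace ((UnitaryGroup.cmDatum L 3 H').Local v ⧸ Subgroup.centralizer ({γ} : Set ((UnitaryGroup.cmDatum L 3 H').Local v)))]
      [∀ γ : (UnitaryGroup.cmDatum L 3 H').Local v, BorelSpace ((UnitaryGroup.cmDatum L 3 H').Local v ⧸ Subgroup.centralizer ({γ} : Set ((UnitaryGroup.cmDatum L 3 H').Local v)))]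
      (νHv : Measure ((UnitaryGroup.cmDatum L 2 (Matrix.of fun i j : Fin 2 => if i.val + j.val + 1 = 2 then (1 : L) else 0)).Local v × (UnitaryGroup.cmDatum L 1 (Matrix.of fun i j : Fin 1 => if i.val + j.val + 1 = 1 then (1 : L) else 0)).Local v)) (νGv : Measure ((UnitaryGroup.cmDatum L 3 H').Local v))
      [IsFiniteMeasureOnCompacts νHv] [νHv.IsMulRightInvariant] [νGv.IsHaarMeasure] [νGv.IsMulRightInvariant]
      (Δv : LocalTransferFactor L H' v)
      (mHv : OrbitalMeasureFamily ((UnitaryGroup.cmDatum L 2 (Matrix.of fun i j : Fin 2 => if i.val + j.val + 1 = 2 then (1 : L) else 0)).Local v × (UnitaryGroup.cmDatum L 1 (Matrix.of fun i j : Fin 1 => if i.val + j.val + 1 = 1 then (1 : L) else 0)).Local v)) (mGv : OrbitalMeasureFamily ((UnitaryGroup.cmDatum L 3 H').Local v)),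
      IsLocalTransferDatum L H' v Δv mHv mGv →
      mHv.IsCanonical (IsLocalGRegular L v) νHv →
      mGv.IsCanonical (fun γ : (UnitaryGroup.cmDatum L 3 H').Local v => IsRegularElt (γ.val : GL (Fin 3) (UnitaryGroup.LocalRing L v))) νGv →
      Subsingleton (UnitaryGroup.PlacesOver L v) →
    ∀ z : (UnitaryGroup.cmDatum L 2 (Matrix.of fun i j : Fin 2 => if i.val + j.val + 1 = 2 then (1 : L) else 0)).Local v × (UnitaryGroup.cmDatum L 1 (Matrix.of fun i j : Fin 1 => if i.val + j.val + 1 = 1 then (1 : L) else 0)).Local v, z ∈ Subgroup.center ((UnitaryGroup.cmDatum L 2 (Matrix.of fun i j : Fin 2 => if i.val + j.val + 1 = 2 then (1 : L) else 0)).Local v × (UnitaryGroup.cmDatum L 1 (Matrix.of fun i j : Fin 1 => if i.val + j.val + 1 = 1 then (1 : L) else 0)).Local v) →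
    ∀ (S : Finset (ConjClasses ((UnitaryGroup.cmDatum L 2 (Matrix.of fun i j : Fin 2 => if i.val + j.val + 1 = 2 then (1 : L) else 0)).Local v × (UnitaryGroup.cmDatum L 1 (Matrix.of fun i j : Fin 1 => if i.val + j.val + 1 = 1 then (1 : L) else 0)).Local v))) (mU : OrbitalMeasureFamily ((UnitaryGroup.cmDatum L 2 (Matrix.of fun i j : Fin 2 => if i.val + j.val + 1 = 2 then (1 : L) else 0)).Local v × (UnitaryGroup.cmDatum L 1 (Matrix.of fun i j : Fin 1 => if i.val + j.val + 1 = 1 then (1 : L) else 0)).Local v))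
      (Γ : ConjClasses ((UnitaryGroup.cmDatum L 2 (Matrix.of fun i j : Fin 2 => if i.val + j.val + 1 = 2 then (1 : L) else 0)).Local v × (UnitaryGroup.cmDatum L 1 (Matrix.of fun i j : Fin 1 => if i.val + j.val + 1 = 1 then (1 : L) else 0)).Local v) → (UnitaryGroup.cmDatum L 2 (Matrix.of fun i j : Fin 2 => if i.val + j.val + 1 = 2 then (1 : L) else 0)).Local v × (UnitaryGroup.cmDatum L 1 (Matrix.of fun i j : Fin 1 => if i.val + j.val + 1 = 1 then (1 : L) else 0)).Local v → ℂ),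
      ConjClasses.mk z ∈ S →
      (∀ u ∈ S, ((((Quotient.out u * z⁻¹).1).val : GL (Fin 2) (UnitaryGroup.LocalRing L v)).val - 1) ^ 2 = 0 ∧ (Quotient.out u * z⁻¹).2 = 1) →
      mU.IsAdmissibleOn (fun γ : (UnitaryGroup.cmDatum L 2 (Matrix.of fun i j : Fin 2 => if i.val + j.val + 1 = 2 then (1 : L) else 0)).Local v × (UnitaryGroup.cmDatum L 1 (Matrix.of fun i j : Fin 1 => if i.val + j.val + 1 = 1 then (1 : L) else 0)).Local v => ConjClasses.mk γ ∈ S) →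
      (∀ u ∈ S, ∀ fH : (UnitaryGroup.cmDatum L 2 (Matrix.of fun i j : Fin 2 => if i.val + j.val + 1 = 2 then (1 : L) else 0)).Local v × (UnitaryGroup.cmDatum L 1 (Matrix.of fun i j : Fin 1 => if i.val + j.val + 1 = 1 then (1 : L) else 0)).Local v → ℂ, IsLocSmooth fH →
        Integrable (descConj (Quotient.out u : (UnitaryGroup.cmDatum L 2 (Matrix.of fun i j : Fin 2 => if i.val + j.val + 1 = 2 then (1 : L) else 0)).Local v × (UnitaryGroup.cmDatum L 1 (Matrix.of fun i j : Fin 1 => if i.val + j.val + 1 = 1 then (1 : L) else 0)).Local v) (Subgroup.centralizer ({(Quotient.out u : (UnitaryGroup.cmDatum L 2 (Matrix.of fun i j : Fin 2 => if i.val + j.val + 1 = 2 then (1 : L) else 0)).Local v × (UnitaryGroup.cmDatum L 1 (Matrix.of fun i j : Fin 1 => if i.val + j.val + 1 = 1 then (1 : L) else 0)).Local v)} : Set ((UnitaryGroup.cmDatum L 2 (Matrix.of fun i j : Fin 2 => if i.val + j.val + 1 = 2 then (1 : L) else 0)).Local v × (UnitaryGroup.cmDatum L 1 (Matrix.of fun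 i j : Fin 1 => if i.val + j.val + 1 = 1 then (1 : L) else 0)).Local v)))
          (fun _ hg => Subgroup.mem_centralizer_singleton_iff.1 hg) fH) (mU u)) →
      (∀ fH : (UnitaryGroup.cmDatum L 2 (Matrix.of fun i j : Fin 2 => if i.val + j.val + 1 = 2 then (1 : L) else 0)).Local v × (UnitaryGroup.cmDatum L 1 (Matrix.of fun i j : Fin 1 => if i.val + j.val + 1 = 1 then (1 : L) else 0)).Local v → ℂ, IsLocSmooth fH → ∀ᶠ γ in 𝓝[{γ : (UnitaryGroup.cmDatum L 2 (Matrix.of fun i j : Fin 2 => if i.val + j.val + 1 = 2 then (1 : L) else 0)).Local v × (UnitaryGroup.cmDatum L 1 (Matrix.of fun i j : Fin 1 => if i.val + j.val + 1 = 1 then (1 : L) else 0)).Local v |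
            IsLocalGRegular L v γ ∧ CompactSpace (Subgroup.centralizer ({γ} : Set ((UnitaryGroup.cmDatum L 2 (Matrix.of fun i j : Fin 2 => if i.val + j.val + 1 = 2 then (1 : L) else 0)).Local v × (UnitaryGroup.cmDatum L 1 (Matrix.of fun i j : Fin 1 => if i.val + j.val + 1 = 1 then (1 : L) else 0)).Local v)))}] z,
          stableOrbitalIntegralRel (IsLocalStablyConjH L v) mHv fH γ = ∑ u ∈ S, classOrbitalIntegral mU fH u * Γ u γ) →
    ∀ (c₀ c₁ : ℂ) (a : ConjClasses ((UnitaryGroup.cmDatum L 2 (Matrix.of fun i j : Fin 2 => if i.val + j.val + 1 = 2 then (1 : L) else 0)).Local v × (UnitaryGroup.cmDatum L 1 (Matrix.of fun i j : Fin 1 => if i.val + j.val + 1 = 1 then (1 : L) else 0)).Local v) → ℂ), a (ConjClasses.mk z) = 0 →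
      (∀ᶠ γ in 𝓝[{γ : (UnitaryGroup.cmDatum L 2 (Matrix.of fun i j : Fin 2 => if i.val + j.val + 1 = 2 then (1 : L) else 0)).Local v × (UnitaryGroup.cmDatum L 1 (Matrix.of fun i j : Fin 1 => if i.val + j.val + 1 = 1 then (1 : L) else 0)).Local v |
            IsLocalGRegular L v γ ∧ CompactSpace (Subgroup.centralizer ({γ} : Set ((UnitaryGroup.cmDatum L 2 (Matrix.of fun i j : Fin 2 => if i.val + j.val + 1 = 2 then (1 : L) else 0)).Local v × (UnitaryGroup.cmDatum L 1 (Matrix.of fun i j : Fin 1 => if i.val + j.val + 1 = 1 then (1 : L) else 0)).Local v)))}] z,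
        c₀ + c₁ * ((({c : ConjClasses ((UnitaryGroup.cmDatum L 2 (Matrix.of fun i j : Fin 2 => if i.val + j.val + 1 = 2 then (1 : L) else 0)).Local v × (UnitaryGroup.cmDatum L 1 (Matrix.of fun i j : Fin 1 => if i.val + j.val + 1 = 1 then (1 : L) else 0)).Local v) | IsLocalStablyConjH L v γ (Quotient.out c)} : Set (ConjClasses ((UnitaryGroup.cmDatum L 2 (Matrix.of fun i j : Fin 2 => if i.val + j.val + 1 = 2 then (1 : L) else 0)).Local v × (UnitaryGroup.cmDatum L 1 (Matrix.of fun i j : Fin 1 => if i.val + j.val + 1 = 1 then (1 : L) else 0)).Local v))).ncard : ℂ) - 1) + ∑ u ∈ S, a u * Γ u γ = 0) → c₀ = 0 :=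
  Summit.HodgeConjecture.HodgeConjecture.Cruxes.H413.K2E3CentralGermIndependenceNstOfHomogeneityRay.centralGermIndependenceNst_of_homogeneityRayNst
    (Summit.HodgeConjecture.HodgeConjecture.Cruxes.H413.K2E3CentralGermHomogeneityRayNstOfReference.centralGermHomogeneityRayNst_of_reference
      Summit.HodgeConjecture.HodgeConjecture.Cruxes.H413.K2E3CentralUnipotentDualPieces.centralUnipotentDualPieces
      (Summit.HodgeConjecture.HodgeConjecture.Cruxes.H413.K2E3CentralGermHomogeneityRayNstRefOfUnipotentScaling.centralGermHomogeneityRayNstRef_of_unipotentScaling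
        Summit.HodgeConjecture.HodgeConjecture.Cruxes.H413.K2E3CentralGermExpansionExistence.centralGermExpansionExistence
        Summit.HodgeConjecture.HodgeConjecture.Cruxes.H413.K2E3CentralUnipotentDualPieces.centralUnipotentDualPieces
        (Summit.HodgeConjecture.HodgeConjecture.Cruxes.H413.K2E3CentralUnipotentScalingPackageOfRankOne.centralUnipotentScalingPackage_of_rankOne
          (Summit.HodgeConjecture.HodgeConjecture.Cruxes.H413.K2E3RankOneUnipotentScalingPackageOfIdentity.rankOneUnipotentScalingPackage_of_identity
            Summit.HodgeConjecture.HodgeConjecture.Cruxes.H413.K2E3RankOneUnipotentScalingPackageOne.rankOneUnipotentScalingPackageOne))))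

/-- **(H) PAID BY NAME — INDEPENDENCE OF THE NON-CENTRAL GERMS FROM THE CONSTANTS** (statement = the hosted U3b socket `sig_K2E3CentralGermIndependence` VERBATIM): the same
chain through ★ `centralGermIndependence_of_homogeneityRayNst`. [cite: Rogawski1990, §8.1 Props. 8.1.1–8.1.2 pp. 112–114] [cite: HarishChandra1999AdmissibleDistributions, §3.1 Lemma 3.2] -/
theorem centralGermIndependence :
    ∀ (L : Type) [Field L] [NumberField L] [IsCMField L] (H' : Matrix (Fin 3) (Fin 3) L),
      (H'.map (cmConjRingHom L)).transpose = H' →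
      (∀ x : Fin 3 → L, hermForm (cmConjRingHom L) H' x x = 0 → x = 0) →
    ∀ (v : HeightOneSpectrum (𝓞 ↥(maximalRealSubfield L)))
      [MeasurableSpace ((UnitaryGroup.cmDatum L 2 (Matrix.of fun i j : Fin 2 => if i.val + j.val + 1 = 2 then (1 : L) else 0)).Local v × (UnitaryGroup.cmDatum L 1 (Matrix.of fun i j : Fin 1 => if i.val + j.val + 1 = 1 then (1 : L) else 0)).Local v)] [BorelSpace ((UnitaryGroup.cmDatum L 2 (Matrix.of fun i j : Fin 2 => if i.val + j.val + 1 = 2 then (1 : L) else 0)).Local v × (UnitaryGroup.cmDatum L 1 (Matrix.of fun i j : Fin 1 => if i.val + j.val + 1 = 1 then (1 : L) else 0)).Local v)]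
      [∀ a : (UnitaryGroup.cmDatum L 2 (Matrix.of fun i j : Fin 2 => if i.val + j.val + 1 = 2 then (1 : L) else 0)).Local v × (UnitaryGroup.cmDatum L 1 (Matrix.of fun i j : Fin 1 => if i.val + j.val + 1 = 1 then (1 : L) else 0)).Local v,
        MeasurableSpace (((UnitaryGroup.cmDatum L 2 (Matrix.of fun i j : Fin 2 => if i.val + j.val + 1 = 2 then (1 : L) else 0)).Local v × (UnitaryGroup.cmDatum L 1 (Matrix.of fun i j : Fin 1 => if i.val + j.val + 1 = 1 then (1 : L) else 0)).Local v) ⧸ Subgroup.centralizer ({a} : Set ((UnitaryGroup.cmDatum L 2 (Matrix.of fun i j : Fin 2 => if i.val + j.val + 1 = 2 then (1 : L) else 0)).Local v × (UnitaryGroup.cmDatum L 1 (Matrix.of fun i j : Fin 1 => if i.val + j.val + 1 = 1 then (1 : L) else 0)).Local v)))]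
      [∀ a : (UnitaryGroup.cmDatum L 2 (Matrix.of fun i j : Fin 2 => if i.val + j.val + 1 = 2 then (1 : L) else 0)).Local v × (UnitaryGroup.cmDatum L 1 (Matrix.of fun i j : Fin 1 => if i.val + j.val + 1 = 1 then (1 : L) else 0)).Local v,
        BorelSpace (((UnitaryGroup.cmDatum L 2 (Matrix.of fun i j : Fin 2 => if i.val + j.val + 1 = 2 then (1 : L) else 0)).Local v × (UnitaryGroup.cmDatum L 1 (Matrix.of fun i j : Fin 1 => if i.val + j.val + 1 = 1 then (1 : L) else 0)).Local v) ⧸ Subgroup.centralizer ({a} : Set ((UnitaryGroup.cmDatum L 2 (Matrix.of fun i j : Fin 2 => if i.val + j.val + 1 = 2 then (1 : L) else 0)).Local v × (UnitaryGroup.cmDatum L 1 (Matrix.of fun i j : Fin 1 => if i.val + j.val + 1 = 1 then (1 : L) else 0)).Local v)))]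
      [MeasurableSpace ((UnitaryGroup.cmDatum L 3 H').Local v)] [BorelSpace ((UnitaryGroup.cmDatum L 3 H').Local v)]
      [∀ γ : (UnitaryGroup.cmDatum L 3 H').Local v, MeasurableSpace ((UnitaryGroup.cmDatum L 3 H').Local v ⧸ Subgroup.centralizer ({γ} : Set ((UnitaryGroup.cmDatum L 3 H').Local v)))]
      [∀ γ : (UnitaryGroup.cmDatum L 3 H').Local v, BorelSpace ((UnitaryGroup.cmDatum L 3 H').Local v ⧸ Subgroup.centralizer ({γ} : Set ((UnitaryGroup.cmDatum L 3 H').Local v)))]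
      (νHv : Measure ((UnitaryGroup.cmDatum L 2 (Matrix.of fun i j : Fin 2 => if i.val + j.val + 1 = 2 then (1 : L) else 0)).Local v × (UnitaryGroup.cmDatum L 1 (Matrix.of fun i j : Fin 1 => if i.val + j.val + 1 = 1 then (1 : L) else 0)).Local v)) (νGv : Measure ((UnitaryGroup.cmDatum L 3 H').Local v))
      [IsFiniteMeasureOnCompacts νHv] [νHv.IsMulRightInvariant] [νGv.IsHaarMeasure] [νGv.IsMulRightInvariant]
      (Δv : LocalTransferFactor L H' v)
      (mHv : OrbitalMeasureFamily ((UnitaryGroup.cmDatum L 2 (Matrix.of fun i j : Fin 2 => if i.val + j.val + 1 = 2 then (1 : L) else 0)).Local v × (UnitaryGroup.cmDatum L 1 (Matrix.of fun i j : Fin 1 => if i.val + j.val + 1 = 1 then (1 : L) else 0)).Local v)) (mGv : OrbitalMeasureFamily ((UnitaryGroup.cmDatum L 3 H').Local v)),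
      IsLocalTransferDatum L H' v Δv mHv mGv →
      mHv.IsCanonical (IsLocalGRegular L v) νHv →
      mGv.IsCanonical (fun γ : (UnitaryGroup.cmDatum L 3 H').Local v => IsRegularElt (γ.val : GL (Fin 3) (UnitaryGroup.LocalRing L v))) νGv →
      Subsingleton (UnitaryGroup.PlacesOver L v) →
    ∀ z : (UnitaryGroup.cmDatum L 2 (Matrix.of fun i j : Fin 2 => if i.val + j.val + 1 = 2 then (1 : L) else 0)).Local v × (UnitaryGroup.cmDatum L 1 (Matrix.of fun i j : Fin 1 => if i.val + j.val + 1 = 1 then (1 : L) else 0)).Local v, z ∈ Subgroup.center ((UnitaryGroup.cmDatum L 2 (Matrix.of fun i j : Fin 2 => if i.val + j.val + 1 = 2 then (1 : L) else 0)).Local v × (UnitaryGroup.cmDatum L 1 (Matrix.of fun i j : Fin 1 => if i.val + j.val + 1 = 1 then (1 : L) else 0)).Local v) →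
    ∀ (S : Finset (ConjClasses ((UnitaryGroup.cmDatum L 2 (Matrix.of fun i j : Fin 2 => if i.val + j.val + 1 = 2 then (1 : L) else 0)).Local v × (UnitaryGroup.cmDatum L 1 (Matrix.of fun i j : Fin 1 => if i.val + j.val + 1 = 1 then (1 : L) else 0)).Local v))) (mU : OrbitalMeasureFamily ((UnitaryGroup.cmDatum L 2 (Matrix.of fun i j : Fin 2 => if i.val + j.val + 1 = 2 then (1 : L) else 0)).Local v × (UnitaryGroup.cmDatum L 1 (Matrix.of fun i j : Fin 1 => if i.val + j.val + 1 = 1 then (1 : L) else 0)).Local v))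
      (Γ : ConjClasses ((UnitaryGroup.cmDatum L 2 (Matrix.of fun i j : Fin 2 => if i.val + j.val + 1 = 2 then (1 : L) else 0)).Local v × (UnitaryGroup.cmDatum L 1 (Matrix.of fun i j : Fin 1 => if i.val + j.val + 1 = 1 then (1 : L) else 0)).Local v) → (UnitaryGroup.cmDatum L 2 (Matrix.of fun i j : Fin 2 => if i.val + j.val + 1 = 2 then (1 : L) else 0)).Local v × (UnitaryGroup.cmDatum L 1 (Matrix.of fun i j : Fin 1 => if i.val + j.val + 1 = 1 then (1 : L) else 0)).Local v → ℂ),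
      ConjClasses.mk z ∈ S →
      (∀ u ∈ S, ((((Quotient.out u * z⁻¹).1).val : GL (Fin 2) (UnitaryGroup.LocalRing L v)).val - 1) ^ 2 = 0 ∧ (Quotient.out u * z⁻¹).2 = 1) →
      mU.IsAdmissibleOn (fun γ : (UnitaryGroup.cmDatum L 2 (Matrix.of fun i j : Fin 2 => if i.val + j.val + 1 = 2 then (1 : L) else 0)).Local v × (UnitaryGroup.cmDatum L 1 (Matrix.of fun i j : Fin 1 => if i.val + j.val + 1 = 1 then (1 : L) else 0)).Local v => ConjClasses.mk γ ∈ S) →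
      (∀ u ∈ S, ∀ fH : (UnitaryGroup.cmDatum L 2 (Matrix.of fun i j : Fin 2 => if i.val + j.val + 1 = 2 then (1 : L) else 0)).Local v × (UnitaryGroup.cmDatum L 1 (Matrix.of fun i j : Fin 1 => if i.val + j.val + 1 = 1 then (1 : L) else 0)).Local v → ℂ, IsLocSmooth fH →
        Integrable (descConj (Quotient.out u : (UnitaryGroup.cmDatum L 2 (Matrix.of fun i j : Fin 2 => if i.val + j.val + 1 = 2 then (1 : L) else 0)).Local v × (UnitaryGroup.cmDatum L 1 (Matrix.of fun i j : Fin 1 => if i.val + j.val + 1 = 1 then (1 : L) else 0)).Local v) (Subgroup.centralizer ({(Quotient.out u : (UnitaryGroup.cmDatum L 2 (Matrix.of fun i j : Fin 2 => if i.val + j.val + 1 = 2 then (1 : L) else 0)).Local v × (UnitaryGroup.cmDatum L 1 (Matrix.of fun i j : Fin 1 => if i.val + j.val + 1 = 1 then (1 : L) else 0)).Local v)} : Set ((UnitaryGroup.cmDatum L 2 (Matrix.of fun i j : Fin 2 => if i.val + j.val + 1 = 2 then (1 : L) else 0)).Local v × (UnitaryGroup.cmDatum L 1 (Matrix.of fun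 i j : Fin 1 => if i.val + j.val + 1 = 1 then (1 : L) else 0)).Local v)))
          (fun _ hg => Subgroup.mem_centralizer_singleton_iff.1 hg) fH) (mU u)) →
      (∀ fH : (UnitaryGroup.cmDatum L 2 (Matrix.of fun i j : Fin 2 => if i.val + j.val + 1 = 2 then (1 : L) else 0)).Local v × (UnitaryGroup.cmDatum L 1 (Matrix.of fun i j : Fin 1 => if i.val + j.val + 1 = 1 then (1 : L) else 0)).Local v → ℂ, IsLocSmooth fH → ∀ᶠ γ in 𝓝[{γ : (UnitaryGroup.cmDatum L 2 (Matrix.of fun i j : Fin 2 => if i.val + j.val + 1 = 2 then (1 : L) else 0)).Local v × (UnitaryGroup.cmDatum L 1 (Matrix.of fun i j : Fin 1 => if i.val + j.val + 1 = 1 then (1 : L) else 0)).Local v |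
            IsLocalGRegular L v γ ∧ CompactSpace (Subgroup.centralizer ({γ} : Set ((UnitaryGroup.cmDatum L 2 (Matrix.of fun i j : Fin 2 => if i.val + j.val + 1 = 2 then (1 : L) else 0)).Local v × (UnitaryGroup.cmDatum L 1 (Matrix.of fun i j : Fin 1 => if i.val + j.val + 1 = 1 then (1 : L) else 0)).Local v)))}] z,
          stableOrbitalIntegralRel (IsLocalStablyConjH L v) mHv fH γ = ∑ u ∈ S, classOrbitalIntegral mU fH u * Γ u γ) →
    ∀ (c₀ : ℂ) (a : ConjClasses ((UnitaryGroup.cmDatum L 2 (Matrix.of fun i j : Fin 2 => if i.val + j.val + 1 = 2 then (1 : L) else 0)).Local v × (UnitaryGroup.cmDatum L 1 (Matrix.of fun i j : Fin 1 => if i.val + j.val + 1 = 1 then (1 : L) else 0)).Local v) → ℂ), a (ConjClasses.mk z) = 0 →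
      (∀ᶠ γ in 𝓝[{γ : (UnitaryGroup.cmDatum L 2 (Matrix.of fun i j : Fin 2 => if i.val + j.val + 1 = 2 then (1 : L) else 0)).Local v × (UnitaryGroup.cmDatum L 1 (Matrix.of fun i j : Fin 1 => if i.val + j.val + 1 = 1 then (1 : L) else 0)).Local v |
            IsLocalGRegular L v γ ∧ CompactSpace (Subgroup.centralizer ({γ} : Set ((UnitaryGroup.cmDatum L 2 (Matrix.of fun i j : Fin 2 => if i.val + j.val + 1 = 2 then (1 : L) else 0)).Local v × (UnitaryGroup.cmDatum L 1 (Matrix.of fun i j : Fin 1 => if i.val + j.val + 1 = 1 then (1 : L) else 0)).Local v)))}] z,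
        c₀ + ∑ u ∈ S, a u * Γ u γ = 0) → c₀ = 0 :=
  Summit.HodgeConjecture.HodgeConjecture.Cruxes.H413.K2E3CentralGermIndependenceNstOfHomogeneityRay.centralGermIndependence_of_homogeneityRayNst
    (Summit.HodgeConjecture.HodgeConjecture.Cruxes.H413.K2E3CentralGermHomogeneityRayNstOfReference.centralGermHomogeneityRayNst_of_reference
      Summit.HodgeConjecture.HodgeConjecture.Cruxes.H413.K2E3CentralUnipotentDualPieces.centralUnipotentDualPieces
      (Summit.HodgeConjecture.HodgeConjecture.Cruxes.H413.K2E3CentralGermHomogeneityRayNstRefOfUnipotentScaling.centralGermHomogeneityRayNstRef_of_unipotentScaling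
        Summit.HodgeConjecture.HodgeConjecture.Cruxes.H413.K2E3CentralGermExpansionExistence.centralGermExpansionExistence
        Summit.HodgeConjecture.HodgeConjecture.Cruxes.H413.K2E3CentralUnipotentDualPieces.centralUnipotentDualPieces
        (Summit.HodgeConjecture.HodgeConjecture.Cruxes.H413.K2E3CentralUnipotentScalingPackageOfRankOne.centralUnipotentScalingPackage_of_rankOne
          (Summit.HodgeConjecture.HodgeConjecture.Cruxes.H413.K2E3RankOneUnipotentScalingPackageOfIdentity.rankOneUnipotentScalingPackage_of_identity
            Summit.HodgeConjecture.HodgeConjecture.Cruxes.H413.K2E3RankOneUnipotentScalingPackageOne.rankOneUnipotentScalingPackageOne))))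

end Summit.HodgeConjecture.HodgeConjecture.Cruxes.H413.K2E3CentralGermIndependence

end
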